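import Summits.QuantumFields.BalabanUV.T4Continuum.Support.NE7EtaClosenessWeak
import Summits.QuantumFields.BalabanUV.T4Continuum.Support.NE7EtaSmoothGaugeTransport
import Summits.QuantumFields.BalabanUV.T4Continuum.Support.NE7EtaBackgroundCarrier
import Summits.QuantumFields.BalabanUV.T4Continuum.Support.NE7EtaPlainGradientHolder
import HarnessLib

/-!
# NE7EtaPlainGradientWeak — route #1 of the NE7 crux (node U5), socket `h` AMENDMENT 6 (ROAD-G107 §3): THE WEAK SOCKET `h_w` — the plain (1.13) quantities at rate from `h_w` + ONE smooth-gauge letter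

Cell `pub-balaban`, rung (B)+1 sub-cell t4, lineage `b2b-balaban-t4-ne7-p1`, generation 107 (CRUX PROVER NE7 #1 = OWNER of BINDER row NE7).
Memo `t4/b2b-balaban-t4-ne7-p1-g107/ROAD-G107.md` §2–§3.
WHY (amendment 6).  The END chain consumes the socket of route 1 only through the RATES of the background coordinate — (P) `sup‖Z‖ ≤ A·θ^{24k}` and
(Gᶜ) `‖∇_W Z‖ ≤ C_G·θ^{38k}` (`θ^{18} = L⁻¹`; `NE7EtaPlainGradientHolder.plainReading_le_rate_H` ⟹ `plainReading ≤ (A + C_G)θ^k`).  Amendment 5's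
(Höl½ᶜ) served only the Landau–Kolmogorov step producing (Gᶜ); numerically (NE7b FINDING-1 [NE7bP1-G154-INBOX-11], owner's kit jobs j341908∕j341917) the
block-Landau slice representative carries a codimension-2 junction logarithm in `∇Z` and a lattice-scale edge profile, so neither an M-uniform C¹ letter nor
(Höl½ᶜ) at scale holds on `𝒯_E`.  THE WEAK SOCKET `h_w` therefore asks the gradient RATE directly: representation ∧ (E) ∧ (Lip₁ᶜ) ∧
(Gᶜ_w) `‖Ad (W (x+e κ) μ) (Z (x+e μ) κ) − Z x κ‖ ≤ Λ_G·θ^{38k}` — implied by `h` (amendment 4), `h′` (amendment 5, at fit levels) and `hpt`; the supplier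
has the slack to absorb the junction logarithm ((E) + (S-b) ⟹ `sup‖d_W Z‖ = O(θ^{42k})`, gen 22's `norm_curl_le_rate`; `(1+k)θ^k ≤ C₀`).
WHAT ([folklore]; 0 def, 0 sorry): **`plain_closeness_of_covRootW_oneLetter`** (the socket-free lemmas `letters_at_rates_H`, `plain_reading_le_H`, `plain_letters_of_rates_H`, `plainReading_le_rate_H` are the Holder file's, by name).  Statements and proofs are those of `NE7EtaPlainGradientHolder` VERBATIM except: the last conjunct of the socket is (Gᶜ_w)
(constant `Λ_G`, sign letter `0 ≤ Λ_G` where the original had `0 ≤ Λ_H`), and the covariant-gradient rate constant `16l₁²γ + √2Λ_H` becomes `Λ_G`.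
HONEST FRAMING (page 1): consumer-side re-typing over landed kernel theorems; `h_w` is a HYPOTHESIS, asserted for no class; nothing of NE3∕NE7 discharged;
nothing of Bałaban's asserted as an axiom; spine count = dagwriter∕referees' call; FIXED FINITE T⁴, rung (B)+1 — NOT infinite volume, NOT mass gap, NOT
BetaPertH, NOT Clay (continuum YM on T⁴ ⇐ BetaPertH ∧ nine spine estimates).
-/

set_option autoImplicit false

open scoped BigOperators Matrix Matrix.Norms.L2Operator
open Finset NormedSpace

namespace Summit.QuantumFields.BalabanUV.T4Continuum.NE7EtaPlainGradientWeak

open Literature.MathematicalPhysics.QuantumFieldTheory.Balaban1983to89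
open B7Prop1Explicit B7Prop2Explicit
open T4AveragingDeficitWall hiding Site Plane Plaq Bond
open T4AveragingDeficitWallBoundary (periodBox IsPeriodicCfg)
open AveragingDeficitPeriodicCounting (IsPeriodicDir)
open MinimalActionSandwich (IsMinimiser)
open MinimalActionRate (Regular)
open NE3EnergyShapes (residualScale IsUnitarySite IsPeriodicSite)
open NE3EnergyWeightedShapes (energyNormW)
open AveragingDeficitDualResidual (dualC1 dualC2)
open AveragingDeficitDerivWallProof (wallConst)
open NE7EtaRatesD4CovReg (unitary_periodic_rescale_bavg_of_regular)
open NE7EtaPlainGradientLetters (norm_plainSup_le norm_plainGrad_le)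
open NE7EtaSmoothGaugeTransport (norm_rescale_bavg_sub_one_le letter_grad_of_sup)
open NE7EtaClosenessWeak (closeness_of_covRootW)
open NE7EtaBackgroundCarrier (plainReading diffCfg reading_le)

open NE7EtaPlainGradientHolder (plain_letters_of_rates_H)

noncomputable section

variable {n : Type*} [Fintype n] [DecidableEq n]

/-! ## The plain reading from the weak socket `h_w` and ONE smooth-gauge letter on `U_B` -/

/-- **THE BACKGROUND COORDINATE IN THE PLAIN READING FROM `h_w` + ONE SMOOTH-GAUGE LETTER ON `U_B`** (`d = 4`, base `θ^{18} = L⁻¹`): hypotheses of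
`NE7EtaClosenessHolder.closeness_of_covRootW` verbatim, plus `θ ≤ 1`, `8l₁²γθ^{24k} ≤ 1`, and: the given run-B minimiser is bondwise `exp A_B` with
`sup‖A_B‖ ≤ σ_B·θ^{18(k+1)}` (`σ_B ≥ 0`) with `10L·σ_Bθ^{18(k+1)} ≤ 1∕64`.  THEN `∃ u Z` with the representation and (i) bond distance `≤ 16l₁²γ·θ^{24k}`,
(ii) plain gradient `≤ (Λ_G + 16l₁²γ(60σ_B) + 128l₁⁴γ²)·θ^{38k}`. [folklore] -/
theorem plain_closeness_of_covRootW_oneLetter [Nonempty n] {𝒞 : ℕ → Set (Site 4 → Fin 4 → (Matrix n n ℂ)ˣ)} {L N : ℕ}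
    (hL : 2 ≤ L) (hN : 1 ≤ N) {θ : ℝ} (hθ : 0 < θ) (hθ1 : θ ≤ 1) (hθ18 : θ ^ 18 = ((L : ℝ))⁻¹) {b g C Λ₁ ΛG : ℝ}
    (hb : 0 ≤ b) (hbs : 512 * (4 + 1) * (4 + 4) * (L : ℝ) ^ 2 * b ≤ 1) (hg : 0 ≤ g) (hC : 0 ≤ C)
    {dom : Set (Site 4 → Fin 4 → (Matrix n n ℂ)ˣ)}
    (h : ∀ k : ℕ, 1 ≤ k → ∀ V ∈ dom, ∀ UA UB : Site 4 → Fin 4 → (Matrix n n ℂ)ˣ,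
      IsMinimiser 4 𝒞 L N k V UA → IsMinimiser 4 𝒞 L N (k + 1) V UB → Regular 4 L N b g (k + 1) UB →
        ∃ (u : Site 4 → (Matrix n n ℂ)ˣ) (Z : Site 4 → Fin 4 → Matrix n n ℂ),
          IsUnitarySite u ∧ IsPeriodicSite u ((N * L ^ k : ℕ) : ℤ) ∧
          IsSkewDir Z ∧ IsPeriodicDir Z ((N * L ^ k : ℕ) : ℤ) ∧
          gaugeAct u UA = vary (rescale L (bavg L UB)) Z 1 ∧
          energyNormW L k (rescale L (bavg L UB)) Z (periodBox (N * L ^ k)) ≤ C * residualScale 4 L N b g k ∧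
          (∀ (κ : Fin 4) (x : Site 4) (μ : Fin 4),
            ‖Ad (rescale L (bavg L UB) (x + e κ) μ) (Z (x + e μ) κ) - Z x κ‖ ≤ Λ₁ * (((L : ℝ)⁻¹) ^ k) ^ 2) ∧
          (∀ (κ : Fin 4) (x : Site 4) (μ : Fin 4),
            ‖Ad (rescale L (bavg L UB) (x + e κ) μ) (Z (x + e μ) κ) - Z x κ‖ ≤ ΛG * θ ^ (38 * k)))
    {γ l₁ : ℝ} (hγ : 0 < γ)
    (hγ3 : C * (wallConst 4 L * (N : ℝ) ^ 2 * (Real.sqrt g * dualC2 4 L + 2 * b ^ 2 * dualC1 4 L)) ≤ γ ^ 3)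
    (hl₁ : 0 < l₁) (hΛl₁ : Λ₁ ≤ l₁ ^ 3)
    {k : ℕ} (hk : 1 ≤ k) (hfit : γ * ((θ ^ 3) ^ k) ^ 2 ≤ l₁ * N) (hp1 : 8 * l₁ ^ 2 * γ * θ ^ (24 * k) ≤ 1)
    {V : Site 4 → Fin 4 → (Matrix n n ℂ)ˣ} (hV : V ∈ dom) {UA UB : Site 4 → Fin 4 → (Matrix n n ℂ)ˣ}
    (hA : IsMinimiser 4 𝒞 L N k V UA) (hB : IsMinimiser 4 𝒞 L N (k + 1) V UB) (hreg : Regular 4 L N b g (k + 1) UB)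
    {σB : ℝ} (hσB : 0 ≤ σB) {AB : Site 4 → Fin 4 → Matrix n n ℂ}
    (hUB : ∀ x κ, ((UB x κ : (Matrix n n ℂ)ˣ) : Matrix n n ℂ) = exp (AB x κ) ∧ ‖AB x κ‖ ≤ σB * θ ^ (18 * (k + 1)))
    (hsmooth : 10 * (L : ℝ) * (σB * θ ^ (18 * (k + 1))) ≤ 1 / 64) :
    ∃ (u : Site 4 → (Matrix n n ℂ)ˣ) (Z : Site 4 → Fin 4 → Matrix n n ℂ),
      IsUnitarySite u ∧ IsPeriodicSite u ((N * L ^ k : ℕ) : ℤ) ∧ IsSkewDir Z ∧ IsPeriodicDir Z ((N * L ^ k : ℕ) : ℤ) ∧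
      gaugeAct u UA = vary (rescale L (bavg L UB)) Z 1 ∧
      (∀ (x : Site 4) (κ : Fin 4),
        ‖((gaugeAct u UA x κ : (Matrix n n ℂ)ˣ) : Matrix n n ℂ) - ((rescale L (bavg L UB) x κ : (Matrix n n ℂ)ˣ) : Matrix n n ℂ)‖
          ≤ 16 * l₁ ^ 2 * γ * θ ^ (24 * k)) ∧
      (∀ (x : Site 4) (μ κ : Fin 4),
        ‖(((gaugeAct u UA (x + e μ) κ : (Matrix n n ℂ)ˣ) : Matrix n n ℂ)
              - ((rescale L (bavg L UB) (x + e μ) κ : (Matrix n n ℂ)ˣ) : Matrix n n ℂ))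
            - (((gaugeAct u UA x κ : (Matrix n n ℂ)ˣ) : Matrix n n ℂ)
              - ((rescale L (bavg L UB) x κ : (Matrix n n ℂ)ˣ) : Matrix n n ℂ))‖
          ≤ (ΛG + 16 * l₁ ^ 2 * γ * (60 * σB) + 128 * l₁ ^ 4 * γ ^ 2) * θ ^ (38 * k)) := by
  have hL1 : 1 ≤ L := by omega
  have hL0 : (0 : ℝ) < L := by exact_mod_cast (by omega : 0 < L)
  -- the rates from `h_w`
  obtain ⟨u, Z, hu, huP, hZ, hZP, hrep, hPr, hGr, -⟩ :=
    closeness_of_covRootW hL hN hθ hθ18 hb hbs hg hC h hγ hγ3 hl₁ hΛl₁ hk hfit hV hA hB hreg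
  obtain ⟨hWu, -⟩ := unitary_periodic_rescale_bavg_of_regular hL1 hb hbs hreg
  -- the averaged letter: `‖W_b − 1‖ ≤ 2·(10L)·σ_B θ^{18(k+1)} = 20σ_B·(L θ^{18(k+1)}) = 20σ_B·θ^{18k}`
  have hlen : ((2 * (4 * L) + L + L : ℕ) : ℝ) = 10 * (L : ℝ) := by push_cast; ring
  have ha0 : 0 ≤ σB * θ ^ (18 * (k + 1)) := mul_nonneg hσB (pow_nonneg hθ.le _)
  have hsmall' : ((2 * (4 * L) + L + L : ℕ) : ℝ) * (σB * θ ^ (18 * (k + 1))) ≤ 1 / 64 := by rw [hlen]; exact hsmooth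
  have hW0 : ∀ x κ, ‖((rescale L (bavg L UB) x κ : (Matrix n n ℂ)ˣ) : Matrix n n ℂ) - 1‖ ≤ (20 * σB) * θ ^ (18 * k) := by
    intro x κ
    have h1 := norm_rescale_bavg_sub_one_le (d := 4) hL1 ha0 hUB hsmall' x κ
    rw [hlen] at h1
    have e18 : (L : ℝ) * θ ^ (18 * (k + 1)) = θ ^ (18 * k) := by
      have : θ ^ (18 * (k + 1)) = θ ^ (18 * k) * θ ^ 18 := by
        rw [show 18 * (k + 1) = 18 * k + 18 by ring, pow_add]
      rw [this, hθ18]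
      field_simp
    calc _ ≤ 2 * (10 * (L : ℝ) * (σB * θ ^ (18 * (k + 1)))) := h1
      _ = 20 * σB * ((L : ℝ) * θ ^ (18 * (k + 1))) := by ring
      _ = 20 * σB * θ ^ (18 * k) := by rw [e18]
  have hW1 : ∀ x μ κ, ‖((rescale L (bavg L UB) (x + e μ) κ : (Matrix n n ℂ)ˣ) : Matrix n n ℂ)
      - ((rescale L (bavg L UB) x κ : (Matrix n n ℂ)ˣ) : Matrix n n ℂ)‖ ≤ (40 * σB) * θ ^ (18 * k) := by
    intro x μ κ
    have h2 := letter_grad_of_sup hW0 x μ κ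
    linarith
  have h20 : 0 ≤ 20 * σB := by positivity
  have h40 : 0 ≤ 40 * σB := by positivity
  have ha : 0 ≤ 8 * l₁ ^ 2 * γ := by positivity
  obtain ⟨hsup, hgrad⟩ := plain_letters_of_rates_H (c := ΛG) hWu hθ hθ1 ha h20 h40 hp1 hPr hGr hW0 hW1
  have e1 : 2 * (8 * l₁ ^ 2 * γ) = 16 * l₁ ^ 2 * γ := by ring
  have e2 : ΛG + 2 * (8 * l₁ ^ 2 * γ) * (20 * σB + 40 * σB) + 2 * (8 * l₁ ^ 2 * γ) ^ 2
      = ΛG + 16 * l₁ ^ 2 * γ * (60 * σB) + 128 * l₁ ^ 4 * γ ^ 2 := by ring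
  refine ⟨u, Z, hu, huP, hZ, hZP, hrep, ?_, ?_⟩
  · intro x κ
    rw [hrep, ← e1]
    exact hsup x κ
  · intro x μ κ
    rw [hrep, ← e2]
    exact hgrad x μ κ

end

end Summit.QuantumFields.BalabanUV.T4Continuum.NE7EtaPlainGradientWeak
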